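import Literature.Combinatorics.StablePolynomials.StabilityPreserversAllDegrees
import Literature.Combinatorics.StablePolynomials.SupportJumpSystem
import HarnessLib

/-!
# `H_θ`-stability and Borcea–Brändén II, Theorem 3.1 (preservers of `H_θ`-stability, every `θ`, every `κ`)

J. Borcea, P. Brändén, *The Lee–Yang and Pólya–Schur programs. II. Theory of stable polynomials and
applications*, Comm. Pure Appl. Math. 62 (2009) 1595–1631 (arXiv:0809.3087).

§1 (p. 5): "`f ∈ ℂ[z_1,…,z_n]` is `Ω`-stable if `f ≠ 0` on `Ωⁿ` … open half-planes bordering on the origin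
`H_θ = {z ∈ ℂ : Im(e^{iθ} z) > 0}`, where `θ ∈ [0,2π)`. Note that `H_0` is the open upper half-plane while `H_{π/2}`
is the open right half-plane. … The notions of `H_θ`-stability are equivalent modulo rotations for complex
polynomials."

§3:
> **Theorem 3.1.** Let `κ ∈ ℕⁿ`, `T : ℂ_κ[z_1,…,z_n] → ℂ[z_1,…,z_n]` be a linear operator, and `C = H_θ` for some
> `0 ≤ θ < 2π`. Then `T` preserves `C`-stability if and only if
> (a) `T` has range of dimension at most one and is of the form `T(f) = α(f)P`, where `α` is a linear functional on
> `ℂ_κ[z_1,…,z_n]` and `P` is a `C`-stable polynomial, or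
> (b) the polynomial (in `2n` variables) `T[(z+w)^κ] := Σ_{α ≤ κ} binom(κ,α) T(z^α) w^{κ-α}` is `C`-stable.

The case `θ = 0` (`H_0 = ℋ`) is Borcea–Brändén I, Theorem 1.1, in the tree for every `κ ∈ ℕⁿ`
(`BorceaBranden_stabilityPreserver_iff'`, `StabilityPreserversAllDegrees.lean`). This file defines `H_θ`-stability
for a fixed `θ` (`IsHThetaStable θ`; the tree's `HasHalfPlaneProperty` of Brändén 2007 is the existential version,
linked in `hasHalfPlaneProperty_iff_exists_isHThetaStable`), the rotation of the variables `z_i ↦ u z_i`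
(`rotateVars u`), proves "equivalent modulo rotations" (`isHThetaStable_iff_rotateVars`: `f` is `H_θ`-stable iff
`f(e^{-iθ} z)` is `ℋ`-stable), and deduces Theorem 3.1 for every `θ ∈ ℝ` and every `κ` by conjugating `T` with the
rotation: `T' = R_θ⁻¹ ∘ T ∘ R_θ` (`R_θ f = f(e^{iθ} z)`) preserves `ℋ`-stability on `ℂ_κ[z]` iff `T` preserves
`H_θ`-stability there, the rank-one alternatives correspond, and
`T'[(z+w)^κ](z) = e^{iθ|κ|} · T[(z+w')^κ](e^{-iθ} z)` with `w' = e^{-iθ} w` (`rotateVars_prod_X_add_C_pow`), so the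
symbol of `T'` is `ℋ`-stable iff the symbol of `T` is `H_θ`-stable.

`θ` ranges over all of `ℝ` (only `e^{iθ}` matters). "Preserves `C`-stability" is spelled out as everywhere in the
tree: `T f` is `C`-stable or `T f = 0` for every `C`-stable `f ∈ ℂ_κ[z]`.

## Contents

* §1 `thetaUnit θ = e^{iθ}`, `IsHThetaStable θ`; `isHThetaStable_zero_iff`, `isHThetaStable_pi_div_two_iff`,
  `IsHThetaStable.hasHalfPlaneProperty`, `hasHalfPlaneProperty_iff_exists_isHThetaStable`.
* §2 `rotateVars u`: `rotateVars_X`, `rotateVars_C`, `rotateVars_C_mul`, `eval_rotateVars`, `rotateVars_comp_rotateVars`,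
  `rotateVars_rotateVars`, `rotateVars_one`, `rotateVars_inv_rotateVars`, `rotateVars_rotateVars_inv`,
  `degreeOf_rotateVars_le`, `rotateVars_prod_X_add_C_pow`.
* §3 **`isHThetaStable_iff_rotateVars`**, `isHThetaStable_rotateVars_iff`, `isHThetaStable_boundedDegreeSymbol_iff`,
  **`BorceaBranden_hThetaStabilityPreserver_iff`** (Theorem 3.1).

## References

* [BorceaBranden2009II] J. Borcea, P. Brändén, Comm. Pure Appl. Math. 62 (2009) 1595–1631, §1 (`H_θ`,
  `Ω`-stability), §3 Thm. 3.1.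
* [BorceaBranden2009] J. Borcea, P. Brändén, Invent. Math. 177 (2009) 541–569, §1.1 Thm. 1.1.
* [Branden2007] P. Brändén, Adv. Math. 216 (2007) 302–320, §1 (half-plane property), §3 proof of Thm. 3.2
  (rotation to the upper half-plane).
-/

noncomputable section

open MvPolynomial Finset

namespace Literature.Combinatorics.StablePolynomials

variable {σ : Type*}

/-! ## §1 `H_θ`-stability -/

section Def

/-- **`e^{iθ}`**, the unit defining `H_θ = {z : Im(e^{iθ} z) > 0}`. [cite: BorceaBranden2009II, §1 (definition of
`H_θ`)] -/
def thetaUnit (θ : ℝ) : ℂ :=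
  Complex.exp (θ * Complex.I)

/-- `e^{iθ} ≠ 0`. [cite: BorceaBranden2009II, §1 (definition of `H_θ`)] -/
theorem thetaUnit_ne_zero (θ : ℝ) : thetaUnit θ ≠ 0 :=
  Complex.exp_ne_zero _

/-- `|e^{iθ}| = 1`. [cite: BorceaBranden2009II, §1 (definition of `H_θ`)] -/
theorem norm_thetaUnit (θ : ℝ) : ‖thetaUnit θ‖ = 1 := by
  rw [thetaUnit, Complex.norm_exp_ofReal_mul_I]

/-- `e^{i·0} = 1`. [cite: BorceaBranden2009II, §1 ("`H_0` is the open upper half-plane")] -/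
theorem thetaUnit_zero : thetaUnit 0 = 1 := by
  rw [thetaUnit, Complex.ofReal_zero, zero_mul, Complex.exp_zero]

/-- `e^{iπ/2} = i`. [cite: BorceaBranden2009II, §1 ("`H_{π/2}` is the open right half-plane")] -/
theorem thetaUnit_pi_div_two : thetaUnit (Real.pi / 2) = Complex.I := by
  rw [thetaUnit, Complex.exp_mul_I]
  push_cast
  rw [Complex.cos_pi_div_two, Complex.sin_pi_div_two, zero_add, one_mul]

/-- **`H_θ`-stability** ("`f ∈ ℂ[z_1,…,z_n]` is `Ω`-stable if `f ≠ 0` on `Ωⁿ`", with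
`Ω = H_θ = {z ∈ ℂ : Im(e^{iθ} z) > 0}`): `p(z) ≠ 0` whenever `Im(e^{iθ} z_i) > 0` for all `i`. Stated for every
`θ ∈ ℝ` (the paper takes `θ ∈ [0,2π)`; only `e^{iθ}` matters). [cite: BorceaBranden2009II, §1 (definitions of
`Ω`-stable and `H_θ`)] -/
def IsHThetaStable (θ : ℝ) (p : MvPolynomial σ ℂ) : Prop :=
  ∀ z : σ → ℂ, (∀ i, 0 < (thetaUnit θ * z i).im) → eval z p ≠ 0

/-- Unfolding `IsHThetaStable`. [cite: BorceaBranden2009II, §1] -/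
theorem isHThetaStable_iff (θ : ℝ) (p : MvPolynomial σ ℂ) :
    IsHThetaStable θ p ↔ ∀ z : σ → ℂ, (∀ i, 0 < (thetaUnit θ * z i).im) → eval z p ≠ 0 :=
  Iff.rfl

/-- **`H_0`-stable = stable** ("`H_0` is the open upper half-plane … `H_0`-stable polynomials are referred to as
stable polynomials"). [cite: BorceaBranden2009II, §1] -/
theorem isHThetaStable_zero_iff (p : MvPolynomial σ ℂ) : IsHThetaStable 0 p ↔ IsUpperHalfPlaneStable p := by
  simp only [IsHThetaStable, IsUpperHalfPlaneStable, thetaUnit_zero, one_mul]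

/-- **`H_{π/2}`-stable = weakly Hurwitz stable** ("`H_{π/2}` is the open right half-plane"): non-vanishing whenever
all `Re z_i > 0`. [cite: BorceaBranden2009II, §1] -/
theorem isHThetaStable_pi_div_two_iff (p : MvPolynomial σ ℂ) :
    IsHThetaStable (Real.pi / 2) p ↔ ∀ z : σ → ℂ, (∀ i, 0 < (z i).re) → eval z p ≠ 0 := by
  simp only [IsHThetaStable, thetaUnit_pi_div_two, Complex.I_mul_im]

/-- An `H_θ`-stable polynomial has Brändén's half-plane property (tree `HasHalfPlaneProperty`, the existential
version). [cite: Branden2007, §1 (half-plane property)] -/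
theorem IsHThetaStable.hasHalfPlaneProperty {θ : ℝ} {p : MvPolynomial σ ℂ} (h : IsHThetaStable θ p) :
    HasHalfPlaneProperty p :=
  ⟨thetaUnit θ, norm_thetaUnit θ, h⟩

/-- **The half-plane property is `H_θ`-stability for some `θ`** (every unit is `e^{iθ}` with `θ = arg u`).
[cite: Branden2007, §1 (half-plane property)] [cite: BorceaBranden2009II, §1 (definition of `H_θ`)] -/
theorem hasHalfPlaneProperty_iff_exists_isHThetaStable (p : MvPolynomial σ ℂ) :
    HasHalfPlaneProperty p ↔ ∃ θ : ℝ, IsHThetaStable θ p := by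
  constructor
  · rintro ⟨u, hu, h⟩
    refine ⟨Complex.arg u, fun z hz => h z fun i => ?_⟩
    have hu' : thetaUnit (Complex.arg u) = u := by
      rw [thetaUnit, ← one_mul (Complex.exp _), ← Complex.ofReal_one, ← hu]
      exact Complex.norm_mul_exp_arg_mul_I u
    rw [← hu']
    exact hz i
  · rintro ⟨θ, h⟩
    exact h.hasHalfPlaneProperty

end Def

/-! ## §2 Rotating the variables -/

section Rotate

/-- **The rotation `z_i ↦ u z_i` of all variables** (`(rotateVars u f)(z) = f(u z)`), an algebra endomorphism of
`ℂ[z_σ]`. [cite: BorceaBranden2009II, §1 ("equivalent modulo rotations")] [cite: Branden2007, §3 proof of Thm. 3.2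
("`f(e^{-iθ} z_1, …, e^{-iθ} z_n)`")] -/
def rotateVars (u : ℂ) : MvPolynomial σ ℂ →ₐ[ℂ] MvPolynomial σ ℂ :=
  bind₁ fun i => C u * X i

/-- `rotateVars u (z_i) = u z_i`. [cite: BorceaBranden2009II, §1] -/
theorem rotateVars_X (u : ℂ) (i : σ) : rotateVars u (X i : MvPolynomial σ ℂ) = C u * X i :=
  bind₁_X_right _ _

/-- `rotateVars u` fixes constants. [cite: BorceaBranden2009II, §1] -/
theorem rotateVars_C (u a : ℂ) : rotateVars u (C a : MvPolynomial σ ℂ) = C a :=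
  bind₁_C_right _ _

/-- `rotateVars u (a·p) = a · rotateVars u p`. [cite: BorceaBranden2009II, §1] -/
theorem rotateVars_C_mul (u a : ℂ) (p : MvPolynomial σ ℂ) : rotateVars u (C a * p) = C a * rotateVars u p := by
  rw [_root_.map_mul, rotateVars_C]

/-- **`(rotateVars u f)(z) = f(u z)`.** [cite: BorceaBranden2009II, §1] -/
theorem eval_rotateVars (u : ℂ) (z : σ → ℂ) (p : MvPolynomial σ ℂ) :
    eval z (rotateVars u p) = eval (fun i => u * z i) p := by
  rw [rotateVars, eval_bind₁]
  simp only [_root_.map_mul, eval_C, eval_X]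

/-- Composition of rotations. [cite: BorceaBranden2009II, §1] -/
theorem rotateVars_comp_rotateVars (u v : ℂ) :
    (rotateVars u).comp (rotateVars v) = (rotateVars (v * u) : MvPolynomial σ ℂ →ₐ[ℂ] MvPolynomial σ ℂ) :=
  algHom_ext fun i => by
    rw [AlgHom.comp_apply, rotateVars_X v i, rotateVars_C_mul, rotateVars_X u i, rotateVars_X (v * u) i, ← mul_assoc,
      ← C_mul]

/-- `rotateVars u (rotateVars v p) = rotateVars (v u) p`. [cite: BorceaBranden2009II, §1] -/
theorem rotateVars_rotateVars (u v : ℂ) (p : MvPolynomial σ ℂ) :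
    rotateVars u (rotateVars v p) = rotateVars (v * u) p := by
  rw [← AlgHom.comp_apply, rotateVars_comp_rotateVars]

/-- `rotateVars 1 = id`. [cite: BorceaBranden2009II, §1] -/
theorem rotateVars_one : (rotateVars 1 : MvPolynomial σ ℂ →ₐ[ℂ] MvPolynomial σ ℂ) = AlgHom.id ℂ _ :=
  algHom_ext fun i => by rw [rotateVars_X, C_1, one_mul, AlgHom.id_apply]

/-- `rotateVars u⁻¹ ∘ rotateVars u = id` for `u ≠ 0`. [cite: BorceaBranden2009II, §1] -/
theorem rotateVars_inv_rotateVars {u : ℂ} (hu : u ≠ 0) (p : MvPolynomial σ ℂ) :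
    rotateVars u⁻¹ (rotateVars u p) = p := by
  rw [rotateVars_rotateVars, mul_inv_cancel₀ hu, rotateVars_one, AlgHom.id_apply]

/-- `rotateVars u ∘ rotateVars u⁻¹ = id` for `u ≠ 0`. [cite: BorceaBranden2009II, §1] -/
theorem rotateVars_rotateVars_inv {u : ℂ} (hu : u ≠ 0) (p : MvPolynomial σ ℂ) :
    rotateVars u (rotateVars u⁻¹ p) = p := by
  rw [rotateVars_rotateVars, inv_mul_cancel₀ hu, rotateVars_one, AlgHom.id_apply]

/-- **Rotations do not raise degrees**: `deg_{z_i} f(uz) ≤ deg_{z_i} f` (so `rotateVars u` maps `ℂ_κ[z]` to itself).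
[cite: BorceaBranden2009II, §3 Thm. 3.1 (the space `ℂ_κ[z_1,…,z_n]`)] [cite: Branden2007, §3 proof of Thm. 3.2
("`supp(f(z)) = supp(f(e^{-iθ} z))`")] -/
theorem degreeOf_rotateVars_le (u : ℂ) (p : MvPolynomial σ ℂ) (i : σ) :
    degreeOf i (rotateVars u p) ≤ degreeOf i p :=
  degreeOf_le_iff.2 fun m hm => by
    have h : coeff m p ≠ 0 := by
      have h1 := mem_support_iff.1 hm
      rw [rotateVars, coeff_bind₁_C_mul_X] at h1
      exact right_ne_zero_of_mul h1
    exact monomial_le_degreeOf i (mem_support_iff.2 h)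

/-- **`(uz + w)^κ = u^{|κ|} (z + u⁻¹w)^κ`**: `rotateVars u (Π_i (z_i + w_i)^{κ_i}) = (Π_i u^{κ_i}) · Π_i (z_i + u⁻¹ w_i)^{κ_i}`.
[cite: BorceaBranden2009II, §3 Thm. 3.1 (b) (the symbol `T[(z+w)^κ]`)] -/
theorem rotateVars_prod_X_add_C_pow [Fintype σ] {u : ℂ} (hu : u ≠ 0) (κ : σ → ℕ) (w : σ → ℂ) :
    rotateVars u (∏ i, (X i + C (w i)) ^ κ i : MvPolynomial σ ℂ) =
      C (∏ i, u ^ κ i) * ∏ i, (X i + C (u⁻¹ * w i)) ^ κ i := by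
  rw [_root_.map_prod (rotateVars u), _root_.map_prod C, ← prod_mul_distrib]
  refine prod_congr rfl fun i _ => ?_
  rw [map_pow, map_add, rotateVars_X, rotateVars_C, C_pow, ← mul_pow, mul_add, ← C_mul,
    mul_inv_cancel_left₀ hu]

end Rotate

/-! ## §3 Equivalence modulo rotations and Theorem 3.1 -/

section Main

/-- **"The notions of `H_θ`-stability are equivalent modulo rotations"**: `f` is `H_θ`-stable iff `f(e^{-iθ} z)`
is stable (`ℋ`-stable). [cite: BorceaBranden2009II, §1] [cite: Branden2007, §3 proof of Thm. 3.2 ("`f` is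
`H`-stable if and only if `f(e^{-iθ} z_1, …, e^{-iθ} z_n)` is Hurwitz stable")] -/
theorem isHThetaStable_iff_rotateVars (θ : ℝ) (p : MvPolynomial σ ℂ) :
    IsHThetaStable θ p ↔ IsUpperHalfPlaneStable (rotateVars (thetaUnit θ)⁻¹ p) := by
  have hu := thetaUnit_ne_zero θ
  constructor
  · intro hp ζ hζ
    rw [eval_rotateVars]
    exact hp _ fun i => by rw [mul_inv_cancel_left₀ hu]; exact hζ i
  · intro h z hz
    have h1 := h (fun i => thetaUnit θ * z i) fun i => hz i
    rw [eval_rotateVars] at h1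
    simp only [inv_mul_cancel_left₀ hu] at h1
    exact h1

/-- `f(e^{iθ} z)` is `H_θ`-stable iff `f` is stable. [cite: BorceaBranden2009II, §1 ("equivalent modulo
rotations")] -/
theorem isHThetaStable_rotateVars_iff (θ : ℝ) (q : MvPolynomial σ ℂ) :
    IsHThetaStable θ (rotateVars (thetaUnit θ) q) ↔ IsUpperHalfPlaneStable q := by
  rw [isHThetaStable_iff_rotateVars, rotateVars_inv_rotateVars (thetaUnit_ne_zero θ)]

variable {τ : Type*} [Fintype τ] [DecidableEq τ]

/-- **`T[(z+w)^κ]` is `H_θ`-stable iff `T[Π_i (z_i + w_i)^{κ_i}](z) ≠ 0` for `z, w ∈ H_θ^τ`.**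
[cite: BorceaBranden2009II, §3 Thm. 3.1 (b)] -/
theorem isHThetaStable_boundedDegreeSymbol_iff (θ : ℝ) (κ : τ → ℕ) (T : MvPolynomial τ ℂ →ₗ[ℂ] MvPolynomial τ ℂ) :
    IsHThetaStable θ (boundedDegreeSymbol κ T) ↔
      ∀ z w : τ → ℂ, (∀ i, 0 < (thetaUnit θ * z i).im) → (∀ i, 0 < (thetaUnit θ * w i).im) →
        eval z (T (∏ i, (X i + C (w i)) ^ κ i)) ≠ 0 := by
  constructor
  · intro h z w hz hw
    have h' := h (Sum.elim z w) fun j => by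
      rcases j with i | i
      · simpa only [Sum.elim_inl] using hz i
      · simpa only [Sum.elim_inr] using hw i
    rwa [eval_boundedDegreeSymbol] at h'
  · intro h zw hzw
    rw [← Sum.elim_comp_inl_inr zw, eval_boundedDegreeSymbol]
    exact h _ _ (fun i => hzw (Sum.inl i)) fun i => hzw (Sum.inr i)

/-- **Borcea–Brändén II, Theorem 3.1 (every `θ`, every `κ ∈ ℕⁿ`).** A linear operator `T` on `ℂ[z_τ]` maps every
`H_θ`-stable polynomial of `ℂ_κ[z_τ]` to an `H_θ`-stable polynomial or to `0` if and only if either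
(a) `T(f) = α(f)P` on `ℂ_κ[z_τ]` for a linear functional `α` and an `H_θ`-stable `P`, or
(b) `T[(z+w)^κ] = Σ_{α≤κ} binom(κ,α) T(z^α) w^{κ-α}` is `H_θ`-stable (in the `2n` variables `z, w`).
Obtained from the case `θ = 0` (Borcea–Brändén I, Thm. 1.1, every `κ`) by conjugation with the rotation
`z ↦ e^{iθ} z`. [cite: BorceaBranden2009II, §3 Thm. 3.1] [cite: BorceaBranden2009, §1.1 Thm. 1.1] -/
theorem BorceaBranden_hThetaStabilityPreserver_iff (θ : ℝ) (κ : τ → ℕ)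
    (T : MvPolynomial τ ℂ →ₗ[ℂ] MvPolynomial τ ℂ) :
    (∀ p : MvPolynomial τ ℂ, (∀ i, degreeOf i p ≤ κ i) → IsHThetaStable θ p →
        IsHThetaStable θ (T p) ∨ T p = 0) ↔
      ((∃ (α : MvPolynomial τ ℂ →ₗ[ℂ] ℂ) (P : MvPolynomial τ ℂ), IsHThetaStable θ P ∧
          ∀ p : MvPolynomial τ ℂ, (∀ i, degreeOf i p ≤ κ i) → T p = α p • P) ∨
        IsHThetaStable θ (boundedDegreeSymbol κ T)) := by
  have hu : thetaUnit θ ≠ 0 := thetaUnit_ne_zero θ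
  -- the conjugated operator `T' = R⁻¹ T R`, `R f = f(e^{iθ} z)`
  set T' : MvPolynomial τ ℂ →ₗ[ℂ] MvPolynomial τ ℂ :=
    (rotateVars (thetaUnit θ)⁻¹).toLinearMap ∘ₗ T ∘ₗ (rotateVars (thetaUnit θ)).toLinearMap with hT'
  have hT'app : ∀ q, T' q = rotateVars (thetaUnit θ)⁻¹ (T (rotateVars (thetaUnit θ) q)) := fun q => rfl
  -- stability and degrees under the rotation
  have hst : ∀ p : MvPolynomial τ ℂ, IsHThetaStable θ p ↔
      IsUpperHalfPlaneStable (rotateVars (thetaUnit θ)⁻¹ p) := isHThetaStable_iff_rotateVars θ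
  have hst' : ∀ q : MvPolynomial τ ℂ, IsHThetaStable θ (rotateVars (thetaUnit θ) q) ↔
      IsUpperHalfPlaneStable q := isHThetaStable_rotateVars_iff θ
  have hdeg : ∀ (v : ℂ) (p : MvPolynomial τ ℂ), (∀ i, degreeOf i p ≤ κ i) →
      ∀ i, degreeOf i (rotateVars v p) ≤ κ i := fun v p hp i => (degreeOf_rotateVars_le v p i).trans (hp i)
  -- (1) `T` preserves `H_θ`-stability on `ℂ_κ[z]` iff `T'` preserves stability there
  have hpres : (∀ p : MvPolynomial τ ℂ, (∀ i, degreeOf i p ≤ κ i) → IsHThetaStable θ p →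
      IsHThetaStable θ (T p) ∨ T p = 0) ↔
      ∀ q : MvPolynomial τ ℂ, (∀ i, degreeOf i q ≤ κ i) → IsUpperHalfPlaneStable q →
        IsUpperHalfPlaneStable (T' q) ∨ T' q = 0 := by
    constructor
    · intro h q hq hs
      rw [hT'app]
      rcases h (rotateVars (thetaUnit θ) q) (hdeg _ q hq) ((hst' q).2 hs) with h1 | h1
      · exact Or.inl ((hst _).1 h1)
      · exact Or.inr (by rw [h1, map_zero])
    · intro h p hp hs
      have h1 := h (rotateVars (thetaUnit θ)⁻¹ p) (hdeg _ p hp) ((hst p).1 hs)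
      rw [hT'app, rotateVars_rotateVars_inv hu] at h1
      rcases h1 with h1 | h1
      · exact Or.inl ((hst _).2 h1)
      · right
        have h2 := congrArg (rotateVars (thetaUnit θ)) h1
        rwa [rotateVars_rotateVars_inv hu, map_zero] at h2
  -- (2) the rank-one alternatives correspond
  have hrank : (∃ (α : MvPolynomial τ ℂ →ₗ[ℂ] ℂ) (P : MvPolynomial τ ℂ), IsUpperHalfPlaneStable P ∧
        ∀ q : MvPolynomial τ ℂ, (∀ i, degreeOf i q ≤ κ i) → T' q = α q • P) ↔
      ∃ (α : MvPolynomial τ ℂ →ₗ[ℂ] ℂ) (P : MvPolynomial τ ℂ), IsHThetaStable θ P ∧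
        ∀ p : MvPolynomial τ ℂ, (∀ i, degreeOf i p ≤ κ i) → T p = α p • P := by
    constructor
    · rintro ⟨α, P, hP, h⟩
      refine ⟨α ∘ₗ (rotateVars (thetaUnit θ)⁻¹).toLinearMap, rotateVars (thetaUnit θ) P, (hst' P).2 hP,
        fun p hp => ?_⟩
      have h1 := h (rotateVars (thetaUnit θ)⁻¹ p) (hdeg _ p hp)
      rw [hT'app, rotateVars_rotateVars_inv hu] at h1
      have h2 := congrArg (rotateVars (thetaUnit θ)) h1
      rw [rotateVars_rotateVars_inv hu, map_smul] at h2
      rw [h2, LinearMap.comp_apply, AlgHom.toLinearMap_apply]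
    · rintro ⟨α, P, hP, h⟩
      refine ⟨α ∘ₗ (rotateVars (thetaUnit θ)).toLinearMap, rotateVars (thetaUnit θ)⁻¹ P, (hst P).1 hP,
        fun q hq => ?_⟩
      rw [hT'app, h _ (hdeg _ q hq), map_smul, LinearMap.comp_apply, AlgHom.toLinearMap_apply]
  -- (3) the symbols correspond: `T'[(z+w)^κ](z) = e^{iθ|κ|} T[(z+w')^κ](e^{-iθ}z)`, `w' = e^{-iθ}w`
  have hc : (∏ i, thetaUnit θ ^ κ i) ≠ 0 := prod_ne_zero_iff.2 fun i _ => pow_ne_zero _ hu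
  have hsymb : IsUpperHalfPlaneStable (boundedDegreeSymbol κ T') ↔ IsHThetaStable θ (boundedDegreeSymbol κ T) := by
    rw [isUpperHalfPlaneStable_boundedDegreeSymbol_iff, isHThetaStable_boundedDegreeSymbol_iff]
    constructor
    · intro h z w hz hw
      have h1 := h (fun i => thetaUnit θ * z i) (fun i => thetaUnit θ * w i) hz hw
      rw [hT'app, rotateVars_prod_X_add_C_pow hu, ← smul_eq_C_mul, map_smul, map_smul, smul_eval,
        eval_rotateVars] at h1
      simp only [inv_mul_cancel_left₀ hu] at h1
      exact right_ne_zero_of_mul h1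
    · intro h z w hz hw
      rw [hT'app, rotateVars_prod_X_add_C_pow hu, ← smul_eq_C_mul, map_smul, map_smul, smul_eval, eval_rotateVars]
      refine mul_ne_zero hc (h _ _ (fun i => ?_) fun i => ?_)
      · simp only [mul_inv_cancel_left₀ hu]
        exact hz i
      · rw [mul_inv_cancel_left₀ hu]
        exact hw i
  rw [hpres, BorceaBranden_stabilityPreserver_iff' κ T', hrank, hsymb]

end Main

end Literature.Combinatorics.StablePolynomials

end
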